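import Summits.Ventures.HodgeRepro2.T6N3Iso
import Summits.Ventures.HodgeRepro2.T6N2Datum

/-!
# T6N3Adm — the assembly N3.L8 with an N2-ADMISSIBLE witness (the v2 isotypic step, data form)

Cell pub-hodge-repro2, Tier 6 (README §10), seat t6-p3 (N3 owner, M2). The lead's v2 composition
carrier `NAut2` (T6NAut2, STATUS ll. 5136 / 5186) consumes the isotypic step of N3 in its DATA form:
«`ℓ_A^σ ≢ 0 ∧ ℓ_B^σ ≢ 0 ⟹` some N2-ADMISSIBLE quadruple `(φ_a, φ_b, φ_c, φ_d)` of Schwartz data has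
`⟨F_A(φ_a, φ_b), F_B(φ_c, φ_d)⟩ ≠ 0`», the admissible quadruples being those of t6-p5's N2 datum
(`N2Datum.AdmData`: each component in the line's admissible set `admA … admD`). This file is the
kernel of that step over the N3 datum and an N2 datum.

WHERE THE ADMISSIBILITY COMES FROM. The v1 assembly (`N3Datum.exists_pairing_ne_zero`, T6N3Iso) writes
a non-zero `ψ ∈ σ_f` as a finite combination of single products on each side and expands
`0 ≠ ⟨ψ, ψ⟩`; the witness pair is one of the SPANNING products. So the admissibility of the witness is
the sentence «the admissible Schwartz data of each line SPAN the line's finite Schwartz space»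
(`N2Datum.AdmSpanning`): under it the admissible product module `span {F φ_a φ_b | φ_a ∈ admA,
φ_b ∈ admB}` is the full `productModule` (bilinearity of `F`), v1's `tauPart_le_productModule` applies
verbatim, and the expansion runs over admissible pairs. In the record this is N3.L8's own reading of
«admissible data» — TIER5 l. 783 / l. 846 («admissible data in the sense of B7(b), finite Schwartz data
pure tensors, archimedean data the forced Fock vectors») and N3.9.5 (any level): in N3's words every
finite pure tensor is admissible. The general assembly is ALSO given for arbitrary subsets
(`exists_pairing_ne_zero_on`: it needs only `σ_f ⊆` the admissible product module on both sides), with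
the alternative route to that inclusion when the admissible sets are a proper subset
(`tauPart_le_productModuleOn`: the admissible product module `ρ`-stable — e.g. the spans of the
admissible sets stable under the Weil representation, `N2Datum.AdmStable` — and `ℓ^σ ≢ 0` already on
an admissible product, `ellNonzeroOn`).

Conventions as in T6N3Datum: Mathlib's `⟪x, y⟫_ℂ` is conjugate-linear in `x`; the record's `⟨a, b⟩ =
∫ a \overline{b}` is `⟪b, a⟫_ℂ`.

§8(d): uses an L-value-free non-vanishing device: NO.
-/

namespace Summit.Ventures.HodgeRepro2.T6

open scoped InnerProductSpace

/-! ## 1. A linear-algebra lemma: a common non-zero element of two spans pairs two spanning vectors -/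

/-- If a non-zero `ψ` lies in the spans of `S` and of `T`, some `x ∈ S` and `y ∈ T` have `⟪y, x⟫ ≠ 0`
(expand `0 ≠ ⟪ψ, ψ⟫` in both spanning families; the heart of N3.L8 (4)). -/
theorem exists_inner_ne_zero_of_mem_span {E : Type*} [NormedAddCommGroup E]
    [InnerProductSpace ℂ E] {S T : Set E} {ψ : E} (hS : ψ ∈ Submodule.span ℂ S)
    (hT : ψ ∈ Submodule.span ℂ T) (hψ : ψ ≠ 0) : ∃ x ∈ S, ∃ y ∈ T, ⟪y, x⟫_ℂ ≠ 0 := by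
  by_contra hcon
  have hall : ∀ x ∈ S, ∀ y ∈ T, ⟪y, x⟫_ℂ = 0 := fun x hx y hy => by
    by_contra h
    exact hcon ⟨x, hx, y, hy, h⟩
  obtain ⟨n, a, p, hp⟩ := Submodule.mem_span_set'.mp hS
  obtain ⟨m, b, q, hq⟩ := Submodule.mem_span_set'.mp hT
  apply (inner_self_ne_zero (𝕜 := ℂ)).mpr hψ
  have key : ⟪ψ, ψ⟫_ℂ = ⟪∑ j, b j • (q j : E), ∑ i, a i • (p i : E)⟫_ℂ := by
    rw [hq, hp]
  rw [key, sum_inner]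
  refine Finset.sum_eq_zero fun j _ => ?_
  rw [inner_smul_left, inner_sum]
  refine mul_eq_zero_of_right _ (Finset.sum_eq_zero fun i _ => ?_)
  rw [inner_smul_right, hall _ (p i).2 _ (q j).2, mul_zero]

namespace N3Datum

variable (𝒟 : N3Datum)

/-! ## 2. The admissible product module of a side over two subsets of Schwartz data -/

/-- `M_X(S_a, S_b)`: the span in `L²([G])` of the single products `F(φ_a, φ_b)` with `φ_a ∈ S_a`,
`φ_b ∈ S_b` — `productModule X` restricted to the admissible data (N3.L8 (2) with B7(b)'s data). -/
def productModuleOn (X : N3Side 𝒟.LG 𝒟.Gf) (SA : Set X.Sa) (SB : Set X.Sb) :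
    Submodule ℂ 𝒟.LG :=
  Submodule.span ℂ (Set.image2 (fun φa φb => X.F φa φb) SA SB)

/-- A single product of admissible data lies in the admissible product module. -/
lemma F_mem_productModuleOn {X : N3Side 𝒟.LG 𝒟.Gf} {SA : Set X.Sa} {SB : Set X.Sb} {φa : X.Sa}
    (ha : φa ∈ SA) {φb : X.Sb} (hb : φb ∈ SB) : X.F φa φb ∈ 𝒟.productModuleOn X SA SB :=
  Submodule.subset_span (Set.mem_image2_of_mem ha hb)

/-- The admissible product module lies in the full product module. -/
lemma productModuleOn_le_productModule (X : N3Side 𝒟.LG 𝒟.Gf) (SA : Set X.Sa) (SB : Set X.Sb) :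
    𝒟.productModuleOn X SA SB ≤ 𝒟.productModule X := by
  refine Submodule.span_mono ?_
  rintro _ ⟨φa, _, φb, _, rfl⟩
  exact ⟨(φa, φb), rfl⟩

/-- Bilinearity of `F`: the product of two vectors in the SPANS of the admissible sets lies in the
admissible product module. -/
lemma F_mem_productModuleOn_of_mem_span {X : N3Side 𝒟.LG 𝒟.Gf} {SA : Set X.Sa} {SB : Set X.Sb}
    {φa : X.Sa} (ha : φa ∈ Submodule.span ℂ SA) {φb : X.Sb} (hb : φb ∈ Submodule.span ℂ SB) :
    X.F φa φb ∈ 𝒟.productModuleOn X SA SB := by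
  refine Submodule.span_induction (p := fun a _ => X.F a φb ∈ 𝒟.productModuleOn X SA SB)
    ?_ ?_ ?_ ?_ ha
  · intro a haS
    refine Submodule.span_induction (p := fun b _ => X.F a b ∈ 𝒟.productModuleOn X SA SB)
      ?_ ?_ ?_ ?_ hb
    · intro b hbS
      exact 𝒟.F_mem_productModuleOn haS hbS
    · rw [map_zero]
      exact Submodule.zero_mem _
    · intro b b' _ _ h h'
      rw [map_add]
      exact Submodule.add_mem _ h h'
    · intro c b _ h
      rw [map_smul]
      exact Submodule.smul_mem _ c h
  · rw [map_zero, LinearMap.zero_apply]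
    exact Submodule.zero_mem _
  · intro a a' _ _ h h'
    rw [map_add, LinearMap.add_apply]
    exact Submodule.add_mem _ h h'
  · intro c a _ h
    rw [map_smul, LinearMap.smul_apply]
    exact Submodule.smul_mem _ c h

/-- THE SPANNING SENTENCE IN ACTION: when the admissible data span the Schwartz spaces of both lines,
the admissible product module is the full product module `M_X`. -/
lemma productModuleOn_eq_productModule_of_span_top (X : N3Side 𝒟.LG 𝒟.Gf) {SA : Set X.Sa}
    {SB : Set X.Sb} (hA : Submodule.span ℂ SA = ⊤) (hB : Submodule.span ℂ SB = ⊤) :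
    𝒟.productModuleOn X SA SB = 𝒟.productModule X := by
  refine le_antisymm (𝒟.productModuleOn_le_productModule X SA SB) (Submodule.span_le.mpr ?_)
  rintro _ ⟨⟨φa, φb⟩, rfl⟩
  exact 𝒟.F_mem_productModuleOn_of_mem_span (by rw [hA]; exact Submodule.mem_top)
    (by rw [hB]; exact Submodule.mem_top)

/-- The admissible product module is `G(𝔸_f)`-stable when the spans of the admissible sets are stable
under the Weil representations of the two lines (with the equivariance `R(g)(η_a η_b) =
η_a(ω(g)φ_a) η_b(ω(g)φ_b)`, `ProductEquivariant`). -/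
lemma isStable_productModuleOn (X : N3Side 𝒟.LG 𝒟.Gf) (hPeq : 𝒟.ProductEquivariant X)
    {SA : Set X.Sa} {SB : Set X.Sb} (hSA : ∀ g, ∀ a ∈ SA, X.ωGa g a ∈ Submodule.span ℂ SA)
    (hSB : ∀ g, ∀ b ∈ SB, X.ωGb g b ∈ Submodule.span ℂ SB) :
    𝒟.IsStable (𝒟.productModuleOn X SA SB) := by
  intro g y hy
  refine Submodule.span_induction (p := fun y _ => 𝒟.ρ g y ∈ 𝒟.productModuleOn X SA SB)
    ?_ ?_ ?_ ?_ hy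
  · rintro _ ⟨φa, ha, φb, hb, rfl⟩
    rw [hPeq g]
    exact 𝒟.F_mem_productModuleOn_of_mem_span (hSA g φa ha) (hSB g φb hb)
  · rw [map_zero]
    exact Submodule.zero_mem _
  · intro a b _ _ ha hb
    rw [map_add]
    exact Submodule.add_mem _ ha hb
  · intro c a _ ha
    rw [map_smul]
    exact Submodule.smul_mem _ c ha

/-! ## 3. `ℓ^σ ≢ 0` on admissible products -/

/-- THE CONCLUSION OF PROPOSITION N* ON ADMISSIBLE DATA: `ℓ^σ ≢ 0` on `σ^τ` for a single product of
vertex forms built from data in `S_a × S_b` (`ellNonzero` with the witness pair restricted). -/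
def ellNonzeroOn (X : N3Side 𝒟.LG 𝒟.Gf) (SA : Set X.Sa) (SB : Set X.Sb) : Prop :=
  ∃ φa ∈ SA, ∃ φb ∈ SB, ∃ ψ ∈ 𝒟.sigmaTau X, X.ell φa φb ψ ≠ 0

/-- On spanning admissible sets, `ellNonzero` already holds on an admissible product (bilinearity of
`F` and linearity of `⟪ψ, ·⟫`: if every admissible product is killed by `ψ`, so is every product). -/
lemma ellNonzeroOn_of_span_top (X : N3Side 𝒟.LG 𝒟.Gf) {SA : Set X.Sa} {SB : Set X.Sb}
    (hA : Submodule.span ℂ SA = ⊤) (hB : Submodule.span ℂ SB = ⊤) (hℓ : 𝒟.ellNonzero X) :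
    𝒟.ellNonzeroOn X SA SB := by
  obtain ⟨φa, φb, ψ, hψ, hne⟩ := hℓ
  by_contra hcon
  have hall : ∀ a ∈ SA, ∀ b ∈ SB, ⟪ψ, X.F a b⟫_ℂ = 0 := fun a ha b hb => by
    by_contra h
    exact hcon ⟨a, ha, b, hb, ψ, hψ, h⟩
  have H : ∀ a ∈ Submodule.span ℂ SA, ∀ b ∈ Submodule.span ℂ SB, ⟪ψ, X.F a b⟫_ℂ = 0 := by
    intro a ha
    refine Submodule.span_induction
      (p := fun a _ => ∀ b ∈ Submodule.span ℂ SB, ⟪ψ, X.F a b⟫_ℂ = 0) ?_ ?_ ?_ ?_ ha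
    · intro a haS b hb
      refine Submodule.span_induction (p := fun b _ => ⟪ψ, X.F a b⟫_ℂ = 0) ?_ ?_ ?_ ?_ hb
      · intro b hbS
        exact hall a haS b hbS
      · rw [map_zero, inner_zero_right]
      · intro b b' _ _ h h'
        rw [map_add, inner_add_right, h, h', add_zero]
      · intro c b _ h
        rw [map_smul, inner_smul_right, h, mul_zero]
    · intro b _
      rw [map_zero, LinearMap.zero_apply, inner_zero_right]
    · intro a a' _ _ h h' b hb
      rw [map_add, LinearMap.add_apply, inner_add_right, h b hb, h' b hb, add_zero]
    · intro c a _ h b hb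
      rw [map_smul, LinearMap.smul_apply, inner_smul_right, h b hb, mul_zero]
  exact hne (H φa (by rw [hA]; exact Submodule.mem_top) φb (by rw [hB]; exact Submodule.mem_top))

/-! ## 4. The assembly over admissible data -/

/-- N3.L8 (4), first half, ON ADMISSIBLE DATA (the stable-module route): if the admissible product
module `M_X(S_a, S_b)` is `G(𝔸_f)`-stable and `ℓ^σ ≢ 0` on `σ^τ` for an admissible product, with
`σ = aut i₀`, then `σ_f ⊆ M_X(S_a, S_b)` (the isotypic decomposition `tauPart_le_of_comp_ne_zero`). -/
theorem tauPart_le_productModuleOn (hO : 𝒟.AutOrthogonal) (hst : 𝒟.AutStable)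
    (hsimp : 𝒟.AutSimple) (hnon : 𝒟.AutNonIso hst) (X : N3Side 𝒟.LG 𝒟.Gf)
    (hP : 𝒟.ProductsIn20 X) {SA : Set X.Sa} {SB : Set X.Sb}
    (hstab : 𝒟.IsStable (𝒟.productModuleOn X SA SB)) {i₀ : 𝒟.Aut} (hi₀ : 𝒟.aut i₀ = X.σ)
    (hℓ : 𝒟.ellNonzeroOn X SA SB) : 𝒟.tauPart i₀ ≤ 𝒟.productModuleOn X SA SB := by
  obtain ⟨φa, ha, φb, hb, ψ, hψ, hne⟩ := hℓ
  have hM : 𝒟.productModuleOn X SA SB ≤ 𝒟.V20 :=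
    (𝒟.productModuleOn_le_productModule X SA SB).trans hP
  have hx : X.F φa φb ∈ 𝒟.productModuleOn X SA SB := 𝒟.F_mem_productModuleOn ha hb
  have hxV : X.F φa φb ∈ 𝒟.V20 := hM hx
  have hψσ : ψ ∈ 𝒟.tauPart i₀ := ⟨by rw [hi₀]; exact hψ.1, hψ.2⟩
  have hcomp : 𝒟.comp i₀ (X.F φa φb) ≠ 0 := by
    intro h0
    apply hne
    show ⟪ψ, X.F φa φb⟫_ℂ = 0
    rw [← 𝒟.sum_comp hxV, inner_sum]
    refine Finset.sum_eq_zero fun j _ => ?_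
    by_cases hji : j = i₀
    · rw [hji, h0, inner_zero_right]
    · exact hO i₀ j (Ne.symm hji) ψ hψσ.1 _ (𝒟.comp_mem hxV j).1
  exact 𝒟.tauPart_le_of_comp_ne_zero hO hst hsimp hnon i₀ hM hstab hx hcomp

/-- N3.L8 (4), second half, OVER ARBITRARY SUBSETS: if `σ_f ⊆ M_X(S_a, S_b)` and `σ_f ⊆ M_Y(S_c, S_d)`
and `σ_f ≠ 0`, some single pair of products of ADMISSIBLE data pairs non-trivially — in Mathlib's
convention `⟪F_Y(φ_c, φ_d), F_X(φ_a, φ_b)⟫_ℂ ≠ 0`. -/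
theorem exists_pairing_ne_zero_on (X Y : N3Side 𝒟.LG 𝒟.Gf) {SA : Set X.Sa} {SB : Set X.Sb}
    {SC : Set Y.Sa} {SD : Set Y.Sb} {i₀ : 𝒟.Aut} (hA : 𝒟.tauPart i₀ ≤ 𝒟.productModuleOn X SA SB)
    (hB : 𝒟.tauPart i₀ ≤ 𝒟.productModuleOn Y SC SD) {ψ : 𝒟.LG} (hψ : ψ ∈ 𝒟.tauPart i₀)
    (hψ0 : ψ ≠ 0) :
    ∃ φa ∈ SA, ∃ φb ∈ SB, ∃ φc ∈ SC, ∃ φd ∈ SD, ⟪Y.F φc φd, X.F φa φb⟫_ℂ ≠ 0 := by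
  obtain ⟨x, hx, y, hy, hne⟩ := exists_inner_ne_zero_of_mem_span (hA hψ) (hB hψ) hψ0
  obtain ⟨φa, ha, φb, hb, rfl⟩ := hx
  obtain ⟨φc, hc, φd, hd, rfl⟩ := hy
  exact ⟨φa, ha, φb, hb, φc, hc, φd, hd, hne⟩

/-- N3.L8 (ASSEMBLY) WITH THE SPANNING SENTENCE: if the admissible data of both lines of each side span
the Schwartz spaces, then `ℓ_A^σ ≢ 0 ∧ ℓ_B^σ ≢ 0` on `σ^τ` (the same `σ`) gives single products of
ADMISSIBLE data with `⟨F_X, F_Y⟩ ≠ 0` — v1's `exists_pairing_ne_zero` with the witness located in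
`S_a × S_b × S_c × S_d`. -/
theorem exists_pairing_ne_zero_of_span_top (hO : 𝒟.AutOrthogonal) (hst : 𝒟.AutStable)
    (hsimp : 𝒟.AutSimple) (hnon : 𝒟.AutNonIso hst) (X Y : N3Side 𝒟.LG 𝒟.Gf)
    (hPX : 𝒟.ProductsIn20 X) (hPeqX : 𝒟.ProductEquivariant X) (hPY : 𝒟.ProductsIn20 Y)
    (hPeqY : 𝒟.ProductEquivariant Y) (hσX : 𝒟.SigmaIsAut X) (hσ : Y.σ = X.σ)
    {SA : Set X.Sa} {SB : Set X.Sb} {SC : Set Y.Sa} {SD : Set Y.Sb}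
    (hSA : Submodule.span ℂ SA = ⊤) (hSB : Submodule.span ℂ SB = ⊤)
    (hSC : Submodule.span ℂ SC = ⊤) (hSD : Submodule.span ℂ SD = ⊤)
    (hA : 𝒟.ellNonzero X) (hB : 𝒟.ellNonzero Y) :
    ∃ φa ∈ SA, ∃ φb ∈ SB, ∃ φc ∈ SC, ∃ φd ∈ SD, ⟪Y.F φc φd, X.F φa φb⟫_ℂ ≠ 0 := by
  obtain ⟨i₀, hi₀⟩ := hσX
  have hA' : 𝒟.tauPart i₀ ≤ 𝒟.productModuleOn X SA SB := by
    rw [𝒟.productModuleOn_eq_productModule_of_span_top X hSA hSB]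
    exact 𝒟.tauPart_le_productModule hO hst hsimp hnon X hPX hPeqX hi₀ hA
  have hB' : 𝒟.tauPart i₀ ≤ 𝒟.productModuleOn Y SC SD := by
    rw [𝒟.productModuleOn_eq_productModule_of_span_top Y hSC hSD]
    exact 𝒟.tauPart_le_productModule hO hst hsimp hnon Y hPY hPeqY (hi₀.trans hσ.symm) hB
  obtain ⟨φa, φb, ψ, hψ, hne⟩ := hA
  have hψσ : ψ ∈ 𝒟.tauPart i₀ := ⟨by rw [hi₀]; exact hψ.1, hψ.2⟩
  have hψ0 : ψ ≠ 0 := fun h => hne (by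
    show ⟪ψ, X.F φa φb⟫_ℂ = 0
    rw [h, inner_zero_left])
  exact 𝒟.exists_pairing_ne_zero_on X Y hA' hB' hψσ hψ0

end N3Datum

/-! ## 5. The sentence N2 and N3 share, on the N2 datum, and the admissible assembly over it -/

namespace N2Datum

variable {K : Type*} [Field K] [NumberField K] {F : FaceSetting K} {P : NDatum F} {𝒟 : N3Datum}
  (D : N2Datum F P 𝒟)

/-- [interface: N3.L8 «admissible data (in the sense of B7(b), finite Schwartz data pure tensors, any
level)» ↔ N2's admissible sets `admA … admD` of the four lines — THE SENTENCE N2 AND N3 SHARE: the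
admissible Schwartz data of each line SPAN the line's finite Schwartz space; class AD (on t6-p5's
toy `T6N2Toy`, `admA = … = Set.univ`, it holds outright: `admSpanning_of_univ`)] -/
def AdmSpanning : Prop :=
  Submodule.span ℂ D.admA = ⊤ ∧ Submodule.span ℂ D.admB = ⊤ ∧
    Submodule.span ℂ D.admC = ⊤ ∧ Submodule.span ℂ D.admD = ⊤

/-- [interface: the alternative to `AdmSpanning` when the admissible sets are a proper subset — the
spans of the admissible sets of the four lines are stable under the Weil representations of `G(𝔸_f)`
(so the admissible product modules are `G(𝔸_f)`-stable, `isStable_productModuleOn`); class AD] -/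
def AdmStable : Prop :=
  (∀ g, ∀ a ∈ D.admA, 𝒟.A.ωGa g a ∈ Submodule.span ℂ D.admA) ∧
    (∀ g, ∀ b ∈ D.admB, 𝒟.A.ωGb g b ∈ Submodule.span ℂ D.admB) ∧
    (∀ g, ∀ c ∈ D.admC, 𝒟.B.ωGa g c ∈ Submodule.span ℂ D.admC) ∧
    (∀ g, ∀ d ∈ D.admD, 𝒟.B.ωGb g d ∈ Submodule.span ℂ D.admD)

/-- When the four admissible sets are everything, the spanning sentence holds. -/
theorem admSpanning_of_univ (hA : D.admA = Set.univ) (hB : D.admB = Set.univ)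
    (hC : D.admC = Set.univ) (hD : D.admD = Set.univ) : D.AdmSpanning := by
  refine ⟨?_, ?_, ?_, ?_⟩
  · rw [hA, Submodule.span_univ]
  · rw [hB, Submodule.span_univ]
  · rw [hC, Submodule.span_univ]
  · rw [hD, Submodule.span_univ]

/-- The admissible quadruples of the N2 datum are exactly the elements of the four admissible sets
(`AdmData` unfolded). -/
theorem admData_iff (φa : 𝒟.A.Sa) (φb : 𝒟.A.Sb) (φc : 𝒟.B.Sa) (φd : 𝒟.B.Sb) :
    D.AdmData (φa, φb, φc, φd) ↔ φa ∈ D.admA ∧ φb ∈ D.admB ∧ φc ∈ D.admC ∧ φd ∈ D.admD :=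
  Iff.rfl

/-- N3iso IN THE DATA FORM WITH THE N2-ADMISSIBLE WITNESS (the v2 isotypic step over the N3 datum and
an N2 datum, spanning route): `ℓ_A^σ ≢ 0 ∧ ℓ_B^σ ≢ 0 ⟹ ∃ (φ_a, φ_b, φ_c, φ_d)` ADMISSIBLE DATA with
`⟨F_A(φ_a, φ_b), F_B(φ_c, φ_d)⟩ ≠ 0` — v1's `N3iso_of_datum` plus the sentence `AdmSpanning`. -/
theorem N3iso_of_datum₂ (hAdm : D.AdmSpanning) (hO : 𝒟.AutOrthogonal) (hst : 𝒟.AutStable)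
    (hsimp : 𝒟.AutSimple) (hnon : 𝒟.AutNonIso hst) (hPX : 𝒟.ProductsIn20 𝒟.A)
    (hPeqX : 𝒟.ProductEquivariant 𝒟.A) (hPY : 𝒟.ProductsIn20 𝒟.B)
    (hPeqY : 𝒟.ProductEquivariant 𝒟.B) (hσX : 𝒟.SigmaIsAut 𝒟.A) (hσ : 𝒟.B.σ = 𝒟.A.σ) :
    𝒟.ellNonzero 𝒟.A → 𝒟.ellNonzero 𝒟.B →
      ∃ (φa : 𝒟.A.Sa) (φb : 𝒟.A.Sb) (φc : 𝒟.B.Sa) (φd : 𝒟.B.Sb),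
        D.AdmData (φa, φb, φc, φd) ∧ ⟪𝒟.B.F φc φd, 𝒟.A.F φa φb⟫_ℂ ≠ 0 := by
  intro hA hB
  obtain ⟨φa, ha, φb, hb, φc, hc, φd, hd, hne⟩ :=
    𝒟.exists_pairing_ne_zero_of_span_top hO hst hsimp hnon 𝒟.A 𝒟.B hPX hPeqX hPY hPeqY hσX hσ
      hAdm.1 hAdm.2.1 hAdm.2.2.1 hAdm.2.2.2 hA hB
  exact ⟨φa, φb, φc, φd, ⟨ha, hb, hc, hd⟩, hne⟩

/-- The same on the STABLE route (for admissible sets that are a proper subset): the spans of the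
admissible sets stable under the Weil representations, and `ℓ^σ ≢ 0` already on an admissible product
on each side. -/
theorem N3iso_of_datum₂_stable (hAdmSt : D.AdmStable) (hO : 𝒟.AutOrthogonal)
    (hst : 𝒟.AutStable) (hsimp : 𝒟.AutSimple) (hnon : 𝒟.AutNonIso hst)
    (hPX : 𝒟.ProductsIn20 𝒟.A) (hPeqX : 𝒟.ProductEquivariant 𝒟.A) (hPY : 𝒟.ProductsIn20 𝒟.B)
    (hPeqY : 𝒟.ProductEquivariant 𝒟.B) (hσX : 𝒟.SigmaIsAut 𝒟.A) (hσ : 𝒟.B.σ = 𝒟.A.σ)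
    (hA : 𝒟.ellNonzeroOn 𝒟.A D.admA D.admB) (hB : 𝒟.ellNonzeroOn 𝒟.B D.admC D.admD) :
    ∃ (φa : 𝒟.A.Sa) (φb : 𝒟.A.Sb) (φc : 𝒟.B.Sa) (φd : 𝒟.B.Sb),
      D.AdmData (φa, φb, φc, φd) ∧ ⟪𝒟.B.F φc φd, 𝒟.A.F φa φb⟫_ℂ ≠ 0 := by
  obtain ⟨i₀, hi₀⟩ := hσX
  have hA' := 𝒟.tauPart_le_productModuleOn hO hst hsimp hnon 𝒟.A hPX
    (𝒟.isStable_productModuleOn 𝒟.A hPeqX hAdmSt.1 hAdmSt.2.1) hi₀ hA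
  have hB' := 𝒟.tauPart_le_productModuleOn hO hst hsimp hnon 𝒟.B hPY
    (𝒟.isStable_productModuleOn 𝒟.B hPeqY hAdmSt.2.2.1 hAdmSt.2.2.2) (hi₀.trans hσ.symm) hB
  obtain ⟨φa, _, φb, _, ψ, hψ, hne⟩ := hA
  have hψσ : ψ ∈ 𝒟.tauPart i₀ := ⟨by rw [hi₀]; exact hψ.1, hψ.2⟩
  have hψ0 : ψ ≠ 0 := fun h => hne (by
    show ⟪ψ, 𝒟.A.F φa φb⟫_ℂ = 0
    rw [h, inner_zero_left])
  obtain ⟨φa', ha, φb', hb, φc, hc, φd, hd, hne'⟩ :=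
    𝒟.exists_pairing_ne_zero_on 𝒟.A 𝒟.B hA' hB' hψσ hψ0
  exact ⟨φa', φb', φc, φd, ⟨ha, hb, hc, hd⟩, hne'⟩

end N2Datum

end Summit.Ventures.HodgeRepro2.T6

/-! ## 6. Appendix (append-only revision): monotonicity and the full-set case -/

namespace Summit.Ventures.HodgeRepro2.T6.N3Datum

variable (𝒟 : N3Datum)

/-- The admissible product module is monotone in the admissible sets. -/
lemma productModuleOn_mono (X : N3Side 𝒟.LG 𝒟.Gf) {SA SA' : Set X.Sa} {SB SB' : Set X.Sb}
    (hA : SA ⊆ SA') (hB : SB ⊆ SB') : 𝒟.productModuleOn X SA SB ≤ 𝒟.productModuleOn X SA' SB' :=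
  Submodule.span_mono (Set.image2_subset hA hB)

/-- Over the full sets the admissible product module is the product module `M_X`. -/
lemma productModuleOn_univ (X : N3Side 𝒟.LG 𝒟.Gf) :
    𝒟.productModuleOn X Set.univ Set.univ = 𝒟.productModule X :=
  𝒟.productModuleOn_eq_productModule_of_span_top X Submodule.span_univ Submodule.span_univ

end Summit.Ventures.HodgeRepro2.T6.N3Datum

namespace Summit.Ventures.HodgeRepro2.T6.N2Datum

variable {K : Type*} [Field K] [NumberField K] {F : FaceSetting K} {P : NDatum F} {𝒟 : N3Datum}
  (D : N2Datum F P 𝒟)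

/-- When the four admissible sets are everything, every quadruple of Schwartz data is admissible. -/
theorem admData_of_univ (hA : D.admA = Set.univ) (hB : D.admB = Set.univ) (hC : D.admC = Set.univ)
    (hD : D.admD = Set.univ) (φ : 𝒟.A.Sa × 𝒟.A.Sb × 𝒟.B.Sa × 𝒟.B.Sb) : D.AdmData φ := by
  refine ⟨?_, ?_, ?_, ?_⟩
  · rw [hA]; exact Set.mem_univ _
  · rw [hB]; exact Set.mem_univ _
  · rw [hC]; exact Set.mem_univ _
  · rw [hD]; exact Set.mem_univ _

end Summit.Ventures.HodgeRepro2.T6.N2Datum
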